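import Summits.ValiantsHypothesis.ValiantsHypothesis.Theorems.BarrierLeverTransversalMinorLayoutsEightFaces

/-!
# Route BarrierLever — item `TransversalLayoutsRankLeEight` (stmt-ValiantsHypothesis-19933):
# complexes using every coordinate, with at most two elements per face (claws with edges)

Helper file (`--supports stmt-ValiantsHypothesis-19933`; cell valiant-natproofs, rung V4, 𝒟-side of
door (c); seat val-np-p1 gen 8).  The structure lemmas of `…Claws` (`image_eq_of_claw_edge`,
`image_eq_of_claw_two_edges`) assume `r < 8` to bound face sizes; with eight faces the bound
`card ≤ 2` comes instead from `face_card_le_two_of_full` (`…EightFaces`, `h ≥ 4`).  This file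
restates the structure lemmas with the face-size bound as a hypothesis and adds the three-edge
case and the one-edge degree formula:

* `image_eq_of_claw_edges_of_le_two`: the faces outside `∅` and the singletons are pairs, and
  there are `r - (h + 1)` of them — stated for one, two and three extra faces
  (`image_eq_of_claw_edge_of_le_two`, `…two_edges…`, `…three_edges…`);
* `degree_of_claw_edge`: with one extra pair `e`, the coordinate `x` lies in `[x ∈ e] + 1` faces.

WHAT THIS IS NOT: bookkeeping for a bounded-rank slice of TT; nothing on TT / item 19761 in
general, on crux stmt-ValiantsHypothesis-14610, or on `VP` versus `VNP`.
-/

-- layout Summits/ValiantsHypothesis/ValiantsHypothesis forces the duplicated namespace component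
set_option linter.dupNamespace false

open Matrix Finset

namespace Summit.ValiantsHypothesis.ValiantsHypothesis.Theorems.BarrierLever.FiniteCheck

open Summit.ValiantsHypothesis.ValiantsHypothesis.Theorems.BarrierLever.Compression

/-- The members outside `∅` and the singletons of a full-support complex with faces of size `≤ 2`
are pairs; they number `r - (h + 1)`. -/
theorem outsiders_of_full_of_le_two {h r : ℕ} (u : Fin r → Finset (Fin h))
    (hu : Function.Injective u) (hl : IsLowerSet (Set.range u)) (hfull : ∀ a : Fin h, ∃ i, a ∈ u i)
    (hr : h + 1 ≤ r) (hle2 : ∀ i, (u i).card ≤ 2) :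
    insert (∅ : Finset (Fin h)) (Finset.univ.image fun a : Fin h => ({a} : Finset (Fin h))) ⊆
      Finset.univ.image u ∧
    (Finset.univ.image u \ insert (∅ : Finset (Fin h))
      (Finset.univ.image fun a : Fin h => ({a} : Finset (Fin h)))).card = r - (h + 1) ∧
    ∀ f, f ∈ Finset.univ.image u → f ∉ insert (∅ : Finset (Fin h))
      (Finset.univ.image fun a : Fin h => ({a} : Finset (Fin h))) → f.card = 2 := by
  classical
  obtain ⟨hsub, hcard⟩ := claw_subset_image u hl hfull (by omega)
  have himg : (Finset.univ.image u).card = r := by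
    rw [Finset.card_image_of_injective _ hu, Finset.card_univ, Fintype.card_fin]
  refine ⟨hsub, by rw [Finset.card_sdiff_of_subset hsub, himg, hcard], fun f hfu hfS => ?_⟩
  obtain ⟨i, _, rfl⟩ := Finset.mem_image.mp hfu
  have hle := hle2 i
  rcases Nat.lt_or_ge (u i).card 2 with hlt | hge
  · exfalso
    apply hfS
    rcases Nat.lt_or_ge (u i).card 1 with h0 | h1
    · rw [Finset.card_eq_zero.mp (show (u i).card = 0 by omega)]
      exact Finset.mem_insert_self _ _
    · obtain ⟨a, ha⟩ := Finset.card_eq_one.mp (show (u i).card = 1 by omega)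
      rw [ha, Finset.mem_insert, Finset.mem_image]
      exact Or.inr ⟨a, Finset.mem_univ _, rfl⟩
  · omega

/-- ONE extra face: it is a pair `{p, q}`. -/
theorem image_eq_of_claw_edge_of_le_two {h r : ℕ} (u : Fin r → Finset (Fin h))
    (hu : Function.Injective u) (hl : IsLowerSet (Set.range u)) (hfull : ∀ a : Fin h, ∃ i, a ∈ u i)
    (hr : r = h + 2) (hle2 : ∀ i, (u i).card ≤ 2) :
    ∃ p q : Fin h, p ≠ q ∧ Finset.univ.image u = insert ({p, q} : Finset (Fin h))
      (insert (∅ : Finset (Fin h)) (Finset.univ.image fun a : Fin h => ({a} : Finset (Fin h)))) := by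
  classical
  obtain ⟨hsub, hdiff, hout⟩ := outsiders_of_full_of_le_two u hu hl hfull (by omega) hle2
  set S := insert (∅ : Finset (Fin h))
    (Finset.univ.image fun a : Fin h => ({a} : Finset (Fin h))) with hSdef
  have h1 : (Finset.univ.image u \ S).card = 1 := by rw [hdiff, hr]; omega
  obtain ⟨f, hf⟩ := Finset.card_eq_one.mp h1
  have hfm : f ∈ Finset.univ.image u \ S := by rw [hf]; simp
  rw [Finset.mem_sdiff] at hfm
  obtain ⟨p, q, hpq, rfl⟩ := Finset.card_eq_two.mp (hout f hfm.1 hfm.2)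
  refine ⟨p, q, hpq, ?_⟩
  rw [← Finset.sdiff_union_of_subset hsub, hf]
  rfl

/-- With ONE extra pair `e`, the coordinate `x` lies in `[x ∈ e] + 1` faces. -/
theorem degree_of_claw_edge {h r : ℕ} (u : Fin r → Finset (Fin h)) (hu : Function.Injective u)
    (e : Finset (Fin h)) (he : e.card = 2)
    (himg : Finset.univ.image u = insert e
      (insert (∅ : Finset (Fin h)) (Finset.univ.image fun a : Fin h => ({a} : Finset (Fin h)))))
    (x : Fin h) :
    (Finset.univ.filter fun i => x ∈ u i).card = (if x ∈ e then 1 else 0) + 1 := by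
  classical
  have ee : ((Finset.univ.image u).filter fun y => x ∈ y).card =
      (Finset.univ.filter fun i => x ∈ u i).card := by
    rw [Finset.filter_image, Finset.card_image_of_injective _ hu]
  rw [← ee, himg]
  have hS : (insert (∅ : Finset (Fin h))
      (Finset.univ.image fun a : Fin h => ({a} : Finset (Fin h)))).filter (fun y => x ∈ y) =
      {{x}} := by
    ext t
    simp only [Finset.mem_filter, Finset.mem_insert, Finset.mem_image, Finset.mem_univ, true_and,
      Finset.mem_singleton]
    constructor
    · rintro ⟨ht, hxt⟩
      rcases ht with rfl | ⟨a, rfl⟩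
      · simp at hxt
      · rw [Finset.mem_singleton] at hxt; rw [hxt]
    · rintro rfl
      exact ⟨Or.inr ⟨x, rfl⟩, Finset.mem_singleton_self x⟩
  have hx1 : e ≠ {x} := fun e' => by
    have := congrArg Finset.card e'; rw [he, Finset.card_singleton] at this; omega
  have n1 : e ∉ ({{x}} : Finset (Finset (Fin h))) := by rwa [Finset.mem_singleton]
  rw [Finset.filter_insert, hS]
  by_cases hm : x ∈ e <;> simp only [hm, if_true, if_false]
  · rw [Finset.card_insert_of_notMem n1, Finset.card_singleton]
  · rw [Finset.card_singleton]

/-- TWO extra faces: two distinct pairs. -/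
theorem image_eq_of_claw_two_edges_of_le_two {h r : ℕ} (u : Fin r → Finset (Fin h))
    (hu : Function.Injective u) (hl : IsLowerSet (Set.range u)) (hfull : ∀ a : Fin h, ∃ i, a ∈ u i)
    (hr : r = h + 3) (hle2 : ∀ i, (u i).card ≤ 2) :
    ∃ e₁ e₂ : Finset (Fin h), e₁ ≠ e₂ ∧ e₁.card = 2 ∧ e₂.card = 2 ∧
      Finset.univ.image u = insert e₁ (insert e₂
        (insert (∅ : Finset (Fin h)) (Finset.univ.image fun a : Fin h => ({a} : Finset (Fin h))))) := by
  classical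
  obtain ⟨hsub, hdiff, hout⟩ := outsiders_of_full_of_le_two u hu hl hfull (by omega) hle2
  set S := insert (∅ : Finset (Fin h))
    (Finset.univ.image fun a : Fin h => ({a} : Finset (Fin h))) with hSdef
  have h2 : (Finset.univ.image u \ S).card = 2 := by rw [hdiff, hr]; omega
  obtain ⟨e₁, e₂, hne, he⟩ := Finset.card_eq_two.mp h2
  have h1m : e₁ ∈ Finset.univ.image u \ S := by rw [he]; simp
  have h2m : e₂ ∈ Finset.univ.image u \ S := by rw [he]; simp
  rw [Finset.mem_sdiff] at h1m h2m
  refine ⟨e₁, e₂, hne, hout e₁ h1m.1 h1m.2, hout e₂ h2m.1 h2m.2, ?_⟩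
  rw [← Finset.sdiff_union_of_subset hsub, he, Finset.insert_union, ← Finset.insert_eq]

/-- THREE extra faces: three pairwise distinct pairs. -/
theorem image_eq_of_claw_three_edges_of_le_two {h r : ℕ} (u : Fin r → Finset (Fin h))
    (hu : Function.Injective u) (hl : IsLowerSet (Set.range u)) (hfull : ∀ a : Fin h, ∃ i, a ∈ u i)
    (hr : r = h + 4) (hle2 : ∀ i, (u i).card ≤ 2) :
    ∃ e₁ e₂ e₃ : Finset (Fin h), e₁ ≠ e₂ ∧ e₁ ≠ e₃ ∧ e₂ ≠ e₃ ∧ e₁.card = 2 ∧ e₂.card = 2 ∧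
      e₃.card = 2 ∧ Finset.univ.image u = insert e₁ (insert e₂ (insert e₃
        (insert (∅ : Finset (Fin h)) (Finset.univ.image fun a : Fin h => ({a} : Finset (Fin h)))))) := by
  classical
  obtain ⟨hsub, hdiff, hout⟩ := outsiders_of_full_of_le_two u hu hl hfull (by omega) hle2
  set S := insert (∅ : Finset (Fin h))
    (Finset.univ.image fun a : Fin h => ({a} : Finset (Fin h))) with hSdef
  have h3 : (Finset.univ.image u \ S).card = 3 := by rw [hdiff, hr]; omega
  obtain ⟨e₁, e₂, e₃, h12, h13, h23, he⟩ := Finset.card_eq_three.mp h3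
  have h1m : e₁ ∈ Finset.univ.image u \ S := by rw [he]; simp
  have h2m : e₂ ∈ Finset.univ.image u \ S := by rw [he]; simp
  have h3m : e₃ ∈ Finset.univ.image u \ S := by rw [he]; simp
  rw [Finset.mem_sdiff] at h1m h2m h3m
  refine ⟨e₁, e₂, e₃, h12, h13, h23, hout e₁ h1m.1 h1m.2, hout e₂ h2m.1 h2m.2,
    hout e₃ h3m.1 h3m.2, ?_⟩
  rw [← Finset.sdiff_union_of_subset hsub, he, Finset.insert_union, Finset.insert_union,
    ← Finset.insert_eq]

end Summit.ValiantsHypothesis.ValiantsHypothesis.Theorems.BarrierLever.FiniteCheck
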